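import Summits.QuantumFields.BalabanUV.T4Continuum.Support.VariationalCovariantUpperBound

/-!
# T⁴ programme, spine node NE2 (U1a), lane P2 — LEAF UB⁺ RELATIVE TO A REFERENCE TRANSPORT: the k-uniform upper bound for the
# covariant scalar effective Laplacian with the constraint's transports `T` ARBITRARY (e.g. Bałaban's NESTED composite contours) and
# the competitor built from a REFERENCE transport `T₀` (e.g. the straight taxi contour) with small in-block defect, provided the
# relative phase `T·conj T₀` stays within `γ < 1` of `1` (road owner `b2b-balaban-t4-ne2-p2` gen 11; located finding N-ne2p2g11-2,
# journal CLAIMS.log l.≈10594; `t4/skeletons/NE2-t4-ne2-p2.md` v0.11 §2.D-bis)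

WHY (N-ne2p2g11-2).  The END `VariationalCovariantEnd.towerLimitRate_scalarTower_closed` (p213959) asks, for the SAME transports `T k`,
the nesting identities COMP⁺ (so that ONE⁺'s one-step defects are small: `T k` = nested composites of local one-step transports) AND leaf
UB⁺'s in-block defect `w_k` with `n·w_k ≤ c_w` (`VariationalCovariantUpperBound.exists_ub_scalarPair`, leaf-04 gen 2, p212172).  Nested
composites have in-block defect `Θ(α)` (field strength), NOT `O(α/n)`: for a bond crossing a top-level sub-face inside the unit block the
two lineages enclose `≈ (n/L)²` plaquettes (numerics `HOME/b2b-balaban-t4-ne2-p2-g11/wnest.py`: straight taxi `n·w → 0.71`, nested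
`w → 0.27` constant in `k` at `α = 0.3`).  So the END's binder set is inhabited only near flat data.  The minimum `Δ′_k` itself is
transport-robust; only the specific competitor `conj(T)·bump` pays the `O(α)` jumps of `conj(T_nested)`.  THIS FILE repairs the leaf:

  for unimodular `T`, `T₀` with `‖R·conj T₀(x+e_μ)·T₀(x) − 1‖ ≤ w` on in-block bonds (the reference's thin-ladder defect) and
  `‖T x·conj (T₀ x) − 1‖ ≤ γ < 1` (relative phase; for nested-vs-taxi `γ ≍` the holonomy of `≲ n²` plaquettes `≍ d·α`, a k-UNIFORM
  small-field condition), the competitor `f = conj(T₀)·(β₁^d)⁻¹·ψ_{φ′}`, `φ′ z := φ z / A_z`, `A_z := Q_T(conj(T₀)·(β₁^d)⁻¹·ψ_1)(z)`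
  (`‖A_z − 1‖ ≤ γ`: the bump weights are `≥ 0` with block mean EXACTLY `β₁^d`) satisfies `Q_T f = φ` EXACTLY and
  `Sc f ≤ Λc(n w)/(1−γ)²·nsq φ ≤ Λc(n·w_eff)·nsq φ`, `Λc(x) = 2d·36^d((1+x)²+9)`, `n·w_eff := (4 + n w)/(1−γ) − 1`
  — THE SAME SHAPE as `exists_ub_scalarPair` at a fictitious defect, so the CLASS bound `n·w ≤ c_w` survives as `n·w_eff ≤ (4+c_w)/(1−γ) − 1`
  and every consumer (`scalar_pair_closed`, the END) re-runs letter for letter.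

HONEST FRAMING (T4-DAG p. 1).  Rung (B)+1 only — NOT infinite volume, NOT a mass gap, NOT Clay.  Node NE2 is NOT IN PRINT and NOT
proved here.  MODEL LEVEL: U(1) phases `R` (`‖R‖ ≤ 1`), unit-modulus site transports `T`, `T₀` are DATA; the bound `γ` for Bałaban's
nested-vs-straight contours is a separate GEOMETRIC leaf (skeleton §7 (O10)), not claimed; scalar sector; lattice/physical units as in
leaf-04's file whose energy bound `physDir_comp_le` is used BY NAME.  [folklore]; nothing printed is a hypothesis; no `def … : Prop`;
no `sorry`; axioms standard.  HONEST DEPENDENCY (cell, verbatim): continuum YM on T⁴ ⇐ BetaPertH ∧ nine spine estimates (0/9 proved);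
BetaPertH ⇐ (D1) ∧ (D4) ∧ CAP+tail; G-an2-4 gates asym, D1 and NE2/3/4.
-/

noncomputable section

namespace Summit.QuantumFields.BalabanUV.T4Continuum.VariationalCovariantUpperBoundRel

open Finset
open scoped ComplexConjugate
open Literature.MathematicalPhysics.QuantumFieldTheory.Balaban1983to89
open Literature.MathematicalPhysics.QuantumFieldTheory.Balaban1983to89.B5Prop11Plancherel (Tor fine unitVec)
open Literature.MathematicalPhysics.QuantumFieldTheory.Balaban1983to89.B5Prop11Lower (nsq nsq_nonneg)
open Literature.MathematicalPhysics.QuantumFieldTheory.Balaban1983to89.B5Block118 (bpt)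
open Summit.QuantumFields.BalabanUV.T4Continuum.ScalarBlockTrialFunction (beta1 beta1_ge bumpW bumpW_mem trial trial_bpt sum_bumpW_eq)
open Summit.QuantumFields.BalabanUV.T4Continuum.VariationalCovariantPoincare (QT dirR)
open Summit.QuantumFields.BalabanUV.T4Continuum.VariationalCovariantFederbush (Qc dirU)
open Summit.QuantumFields.BalabanUV.T4Continuum.VariationalCovariantUpperBound (inv_beta_pow_mem physDir_comp_le)

variable {d : ℕ} (n : ℕ) [NeZero n] (M : Fin d → ℕ) [hM : ∀ μ, NeZero (M μ)]

/-! ## §1 The block overlap of the target transports with the reference competitor -/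

/-- the reference competitor for a unit field `φ′`: `conj(T₀)·(β₁^d)⁻¹·ψ_{φ′}` (leaf-04's competitor with `T₀` for `T`). [folklore] -/
def comp₀ (T₀ : Tor (fine n M) → ℂ) (φ' : Tor M → ℂ) (x : Tor (fine n M)) : ℂ :=
  conj (T₀ x) * (((((beta1 n) ^ d)⁻¹ : ℝ) : ℂ) * trial n M φ' x)

/-- the BLOCK OVERLAP `A_z = n^{−d}Σ_{j} T(bpt z j)·conj T₀(bpt z j)·(β₁^d)⁻¹·bumpW j` of the target transports `T` with the reference
competitor's weights. [folklore] -/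
def ovl (T T₀ : Tor (fine n M) → ℂ) (z : Tor M) : ℂ :=
  ((n : ℂ) ^ d)⁻¹ * ∑ j : Fin d → Fin n, T (bpt n M z j) * (conj (T₀ (bpt n M z j)) * (((((beta1 n) ^ d)⁻¹ : ℝ) : ℂ) * ((bumpW n j : ℝ) : ℂ)))

/-- **the transported average of the reference competitor is the overlap times the field**: `Q_T (comp₀ T₀ φ′) z = A_z·φ′ z`. [folklore] -/
theorem QT_comp₀ (T T₀ : Tor (fine n M) → ℂ) (φ' : Tor M → ℂ) (z : Tor M) :
    QT n M T (comp₀ n M T₀ φ') z = ovl n M T T₀ z * φ' z := by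
  unfold QT ovl comp₀
  simp_rw [trial_bpt]
  rw [mul_assoc]
  congr 1
  rw [Finset.sum_mul]
  refine Finset.sum_congr rfl fun j _ => ?_
  ring

/-- the normalised bump weights have block mean EXACTLY one: `n^{−d}·Σ_j (β₁^d)⁻¹·bumpW j = 1`. [folklore] -/
theorem weights_mean_one : ((n : ℝ) ^ d)⁻¹ * ∑ j : Fin d → Fin n, ((beta1 n) ^ d)⁻¹ * bumpW n j = 1 := by
  have hn : (n : ℝ) ≠ 0 := by exact_mod_cast NeZero.ne n
  have hβ : (beta1 n) ^ d ≠ 0 := (pow_pos (beta1_ge n).2 d).ne'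
  rw [← Finset.mul_sum, sum_bumpW_eq, mul_pow]
  field_simp

omit hM in
/-- **the overlap is within `γ` of `1`** when the relative phase `T·conj T₀` is: `‖A_z − 1‖ ≤ γ`. [folklore] -/
theorem norm_ovl_sub_one_le {T T₀ : Tor (fine n M) → ℂ} {γ : ℝ} (hrel : ∀ x, ‖T x * conj (T₀ x) - 1‖ ≤ γ) (z : Tor M) :
    ‖ovl n M T T₀ z - 1‖ ≤ γ := by
  have hn0 : (0 : ℝ) < (n : ℝ) ^ d := by have := NeZero.ne n; positivity
  obtain ⟨hc0, _⟩ := inv_beta_pow_mem n (d := d)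
  -- `A_z − 1 = n^{−d}Σ_j (T·conj T₀ − 1)·(c·w_j)` because the weights have mean one
  have hmean : ((n : ℂ) ^ d)⁻¹ * ∑ j : Fin d → Fin n, (((((beta1 n) ^ d)⁻¹ : ℝ) : ℂ) * ((bumpW n j : ℝ) : ℂ)) = 1 := by
    have h := weights_mean_one n (d := d)
    have hc : ((((n : ℝ) ^ d)⁻¹ * ∑ j : Fin d → Fin n, ((beta1 n) ^ d)⁻¹ * bumpW n j : ℝ) : ℂ)
        = ((n : ℂ) ^ d)⁻¹ * ∑ j : Fin d → Fin n, (((((beta1 n) ^ d)⁻¹ : ℝ) : ℂ) * ((bumpW n j : ℝ) : ℂ)) := by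
      push_cast; rfl
    rw [← hc, h]; simp
  have hdiff : ovl n M T T₀ z - 1 = ((n : ℂ) ^ d)⁻¹ * ∑ j : Fin d → Fin n,
      (T (bpt n M z j) * conj (T₀ (bpt n M z j)) - 1) * (((((beta1 n) ^ d)⁻¹ : ℝ) : ℂ) * ((bumpW n j : ℝ) : ℂ)) := by
    calc ovl n M T T₀ z - 1
        = ovl n M T T₀ z - ((n : ℂ) ^ d)⁻¹ * ∑ j : Fin d → Fin n, (((((beta1 n) ^ d)⁻¹ : ℝ) : ℂ) * ((bumpW n j : ℝ) : ℂ)) := by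
          rw [hmean]
      _ = _ := by
          unfold ovl
          rw [← mul_sub, ← Finset.sum_sub_distrib]
          congr 1
          refine Finset.sum_congr rfl fun j _ => ?_
          ring
  rw [hdiff, norm_mul, norm_inv, norm_pow, Complex.norm_natCast]
  have hterm : ∀ j : Fin d → Fin n, ‖(T (bpt n M z j) * conj (T₀ (bpt n M z j)) - 1) * (((((beta1 n) ^ d)⁻¹ : ℝ) : ℂ) * ((bumpW n j : ℝ) : ℂ))‖
      ≤ γ * (((beta1 n) ^ d)⁻¹ * bumpW n j) := by
    intro j
    rw [norm_mul]
    have hw : ‖(((((beta1 n) ^ d)⁻¹ : ℝ) : ℂ) * ((bumpW n j : ℝ) : ℂ))‖ = ((beta1 n) ^ d)⁻¹ * bumpW n j := by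
      rw [← Complex.ofReal_mul, Complex.norm_real, Real.norm_eq_abs, abs_of_nonneg (mul_nonneg hc0.le (bumpW_mem n j).1)]
    rw [hw]
    exact mul_le_mul_of_nonneg_right (hrel _) (mul_nonneg hc0.le (bumpW_mem n j).1)
  calc ((n : ℝ) ^ d)⁻¹ * ‖∑ j : Fin d → Fin n, (T (bpt n M z j) * conj (T₀ (bpt n M z j)) - 1)
          * (((((beta1 n) ^ d)⁻¹ : ℝ) : ℂ) * ((bumpW n j : ℝ) : ℂ))‖
      ≤ ((n : ℝ) ^ d)⁻¹ * ∑ j : Fin d → Fin n, γ * (((beta1 n) ^ d)⁻¹ * bumpW n j) := by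
        gcongr
        exact (norm_sum_le _ _).trans (Finset.sum_le_sum fun j _ => hterm j)
    _ = γ * (((n : ℝ) ^ d)⁻¹ * ∑ j : Fin d → Fin n, ((beta1 n) ^ d)⁻¹ * bumpW n j) := by rw [← Finset.mul_sum]; ring
    _ = γ := by rw [weights_mean_one n (d := d), mul_one]

omit hM in
/-- hence `‖A_z‖ ≥ 1 − γ` (and `A_z ≠ 0` for `γ < 1`). [folklore] -/
theorem one_sub_le_norm_ovl {T T₀ : Tor (fine n M) → ℂ} {γ : ℝ} (hrel : ∀ x, ‖T x * conj (T₀ x) - 1‖ ≤ γ) (z : Tor M) :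
    1 - γ ≤ ‖ovl n M T T₀ z‖ := by
  have h := norm_ovl_sub_one_le n M hrel z
  have := norm_sub_norm_le (1 : ℂ) (ovl n M T T₀ z)
  rw [norm_one, norm_sub_rev] at this
  linarith

/-! ## §2 UB⁺ relative to the reference transport -/

/-- **LEAF UB⁺ RELATIVE TO A REFERENCE TRANSPORT, `∃`-form in the CAPSTONE's letters**: `T` arbitrary unimodular, reference `T₀`
unimodular with in-block defect `w`, relative phase within `γ < 1` ⟹ `∀ φ, ∃ f, Q_T f = φ ∧ Sc f ≤ Λc(n w)/(1−γ)²·nsq φ`. [folklore] -/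
theorem exists_ub_scalarPair_rel {T T₀ : Tor (fine n M) → ℂ} (hT₀ : ∀ x, ‖T₀ x‖ = 1) {R : Tor (fine n M) → Fin d → ℂ}
    (hR : ∀ x μ, ‖R x μ‖ ≤ 1) {w : ℝ} (hw0 : 0 ≤ w)
    (hw : ∀ (y : Tor M) (j : Fin d → Fin n) (μ : Fin d), (j μ : ℕ) + 1 < n →
      ‖R (bpt n M y j) μ * conj (T₀ (bpt n M y j + unitVec (fine n M) μ)) * T₀ (bpt n M y j) - 1‖ ≤ w)
    {γ : ℝ} (hγ : γ < 1) (hrel : ∀ x, ‖T x * conj (T₀ x) - 1‖ ≤ γ) :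
    ∀ φ : Tor M → ℂ, ∃ f : Tor (fine n M) → ℂ, (fun z => Qc n M T f z) = φ ∧
      (n : ℝ) ^ 2 / (n : ℝ) ^ d * ∑ μ, dirU (fine n M) R f μ
        ≤ 2 * d * (36 : ℝ) ^ d * ((1 + n * w) ^ 2 + 9) / (1 - γ) ^ 2 * nsq φ := by
  intro φ
  have h1γ : 0 < 1 - γ := by linarith
  -- the corrected unit field
  set φ' : Tor M → ℂ := fun z => φ z / ovl n M T T₀ z with hφ'
  have hov : ∀ z, 1 - γ ≤ ‖ovl n M T T₀ z‖ := one_sub_le_norm_ovl n M hrel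
  have hov0 : ∀ z, ovl n M T T₀ z ≠ 0 := fun z => by
    intro h; have := hov z; rw [h, norm_zero] at this; linarith
  refine ⟨comp₀ n M T₀ φ', ?_, ?_⟩
  · funext z
    change QT n M T (comp₀ n M T₀ φ') z = φ z
    rw [QT_comp₀, hφ']
    field_simp [hov0 z]
  · -- energy: leaf-04's bound for `T₀` applied to `φ′`, then `nsq φ′ ≤ nsq φ/(1−γ)²`
    have hE := physDir_comp_le n M hT₀ hR hw0 hw φ'
    have hD : dirR n M R (comp₀ n M T₀ φ') = ∑ μ, dirU (fine n M) R (comp₀ n M T₀ φ') μ := rfl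
    have e : (n : ℝ) ^ 2 / (n : ℝ) ^ d * ∑ μ, dirU (fine n M) R (comp₀ n M T₀ φ') μ
        = ((n : ℝ) ^ d)⁻¹ * ((n : ℝ) ^ 2 * dirR n M R (comp₀ n M T₀ φ')) := by
      rw [div_eq_mul_inv, hD]; ring
    rw [e]
    refine hE.trans ?_
    have hq : nsq φ' ≤ nsq φ / (1 - γ) ^ 2 := by
      unfold nsq
      rw [Finset.sum_div]
      refine Finset.sum_le_sum fun z _ => ?_
      rw [hφ', norm_div, div_pow]
      have h2 : (1 - γ) ^ 2 ≤ ‖ovl n M T T₀ z‖ ^ 2 := pow_le_pow_left₀ h1γ.le (hov z) 2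
      exact div_le_div_of_nonneg_left (sq_nonneg _) (by positivity) h2
    have hΛ : 0 ≤ 2 * (d : ℝ) * (36 : ℝ) ^ d * ((1 + n * w) ^ 2 + 9) := by positivity
    calc 2 * (d : ℝ) * (36 : ℝ) ^ d * ((1 + n * w) ^ 2 + 9) * nsq φ'
        ≤ 2 * (d : ℝ) * (36 : ℝ) ^ d * ((1 + n * w) ^ 2 + 9) * (nsq φ / (1 - γ) ^ 2) := mul_le_mul_of_nonneg_left hq hΛ
      _ = _ := by ring

/-- the relative constant is dominated by leaf-04's shape at the FICTITIOUS defect `n·w_eff = (4 + n w)/(1−γ) − 1`: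
`((1 + n w)² + 9)/(1−γ)² ≤ (1 + n w_eff)² + 9` whenever `(4 + n w)/(1−γ) − 1 ≤ n·w_eff` (`w ≥ 0`, `γ < 1`). [folklore] -/
theorem lamC_rel_le {x x' γ : ℝ} (hx : 0 ≤ x) (hγ : γ < 1) (hx' : (4 + x) / (1 - γ) - 1 ≤ x') :
    ((1 + x) ^ 2 + 9) / (1 - γ) ^ 2 ≤ (1 + x') ^ 2 + 9 := by
  have h1γ : 0 < 1 - γ := by linarith
  have hq : (4 + x) / (1 - γ) ≤ 1 + x' := by linarith
  have hq0 : 0 ≤ (4 + x) / (1 - γ) := by positivity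
  have hsq : ((4 + x) / (1 - γ)) ^ 2 ≤ (1 + x') ^ 2 := pow_le_pow_left₀ hq0 hq 2
  have hnum : (1 + x) ^ 2 + 9 ≤ (4 + x) ^ 2 := by nlinarith
  calc ((1 + x) ^ 2 + 9) / (1 - γ) ^ 2 ≤ (4 + x) ^ 2 / (1 - γ) ^ 2 := by gcongr
    _ = ((4 + x) / (1 - γ)) ^ 2 := by rw [div_pow]
    _ ≤ (1 + x') ^ 2 + 9 := by linarith

/-- **LEAF UB⁺ RELATIVE TO A REFERENCE TRANSPORT IN `exists_ub_scalarPair`'s EXACT SHAPE** at the fictitious defect `w_eff`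
(`(4 + n w)/(1−γ) − 1 ≤ n·w_eff`): `∀ φ, ∃ f, Q_T f = φ ∧ Sc f ≤ 2d·36^d·((1 + n·w_eff)² + 9)·nsq φ` — so every consumer of leaf UB⁺
(`hUBc` of `scalar_pair_bracket_sqrt`, `hREG_rho`'s UB input, `scalar_pair_closed`, the END's CLASS `n·w ≤ c_w`) re-runs letter for
letter with `(T, w_eff)` in place of `(T, w)`. [folklore] -/
theorem exists_ub_scalarPair_rel_eff {T T₀ : Tor (fine n M) → ℂ} (hT₀ : ∀ x, ‖T₀ x‖ = 1) {R : Tor (fine n M) → Fin d → ℂ}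
    (hR : ∀ x μ, ‖R x μ‖ ≤ 1) {w : ℝ} (hw0 : 0 ≤ w)
    (hw : ∀ (y : Tor M) (j : Fin d → Fin n) (μ : Fin d), (j μ : ℕ) + 1 < n →
      ‖R (bpt n M y j) μ * conj (T₀ (bpt n M y j + unitVec (fine n M) μ)) * T₀ (bpt n M y j) - 1‖ ≤ w)
    {γ : ℝ} (hγ : γ < 1) (hrel : ∀ x, ‖T x * conj (T₀ x) - 1‖ ≤ γ)
    {w' : ℝ} (hw' : (4 + n * w) / (1 - γ) - 1 ≤ n * w') :
    ∀ φ : Tor M → ℂ, ∃ f : Tor (fine n M) → ℂ, (fun z => Qc n M T f z) = φ ∧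
      (n : ℝ) ^ 2 / (n : ℝ) ^ d * ∑ μ, dirU (fine n M) R f μ ≤ 2 * d * (36 : ℝ) ^ d * ((1 + n * w') ^ 2 + 9) * nsq φ := by
  intro φ
  obtain ⟨f, hf, hb⟩ := exists_ub_scalarPair_rel n M hT₀ hR hw0 hw hγ hrel φ
  refine ⟨f, hf, hb.trans ?_⟩
  have hx : 0 ≤ (n : ℝ) * w := by positivity
  have h := lamC_rel_le hx hγ hw'
  have hq := nsq_nonneg φ
  have hc : 0 ≤ 2 * (d : ℝ) * (36 : ℝ) ^ d := by positivity
  calc 2 * (d : ℝ) * (36 : ℝ) ^ d * ((1 + n * w) ^ 2 + 9) / (1 - γ) ^ 2 * nsq φ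
      = 2 * (d : ℝ) * (36 : ℝ) ^ d * (((1 + n * w) ^ 2 + 9) / (1 - γ) ^ 2) * nsq φ := by ring
    _ ≤ 2 * (d : ℝ) * (36 : ℝ) ^ d * ((1 + n * w') ^ 2 + 9) * nsq φ := by gcongr

end Summit.QuantumFields.BalabanUV.T4Continuum.VariationalCovariantUpperBoundRel

end
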